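import Literature.MathematicalPhysics.QuantumFieldTheory.Balaban1983to89.B9SectBCodedClassKnitY
import Literature.MathematicalPhysics.QuantumFieldTheory.Balaban1983to89.B9SectBGpFrameCodedYR

/-!
# `Balaban1983to89.B9SectBCodedClassKnitYC` — THE KNIT CODED CLASS's `hclass` OVER THE CLASS-PARAMETRIC CARRIER `bg9YC 𝔸 G P x`
# (the `bg9YC` edition of `B9SectBCodedClassKnitY.hclass_C37KY_at ∕ _on`, as `B9SectBCodedChainR5`'s `…ClassGYR` is of `hclass_C37GY_at ∕ _on`)

T. Bałaban, *Propagators for lattice gauge theories in a background field*, Commun. Math. Phys. **99** (1985) 389–434 [`Balaban1985BackgroundPropagators`, "B9"];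
[5] = T. Bałaban, *Averaging operations for lattice gauge theories*, Commun. Math. Phys. **98** (1985) 17–51 [`Balaban1985Averaging`].

statement-level skeleton of published theorems with citation tags; proofs where landed; nothing here is a claim about the Yang–Mills mass gap

THE PRINTED LOCUS.  (3.35)–(3.37) p. 396 (the classes of the pair `(U, U′)`); p. 401 (the key estimate behind (3.58)); Thm 3.4 p. 400.

WHY THIS FILE (pub-ymgap N06, seat dag-n06-c g26).  `B9SectBCodedClassKnitY.hclass_C37KY_at ∕ _on` key the base's regularity on MODULE 3's member carrier `bg9Y 𝔸 G x`
(used only through its first conjunct «`U` is `G`-valued»); the knit certificate's coded chain lives on the CLASS-PARAMETRIC carrier `bg9YC 𝔸 G P x` (`P := extraYPb` = print's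
class read with `0 ≦ α₀`, `B9SectBCodedClassR.reg335C_iff`), whose (3.37) class `Cplx337` is the same record class.  THIS FILE re-declares the two `hclass` theorems over
`bg9YC 𝔸 G P x` with the proofs VERBATIM (`hreg.1.1` is again «`U` is `G`-valued»): `hclass_C37KY_atC`, `hclass_C37KY_onC`.  At the knit the two displayed laws are now BOTH in the
tree: `ParVar337Y … (parKnitY i) ((bg9KP …).Reg335 c₀) (154(d+1)) αK aK` = dag-n06-l's `B9Eq358KnitTransporterVariationY.parVar337Y_parKnitY` (✓, (K1)) and `ParMemY` = dag-n06-c's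
`N06SectBStepUParKnit.parMemY_parKnitY` (✓) — so `hclass_C37KY_onC` is inhabited at the record modulo x-free numerics and the regime bridge `bg9YC → bg9KP`.

HONEST SCOPE.  Bookkeeping (carrier re-keying) of landed theorems; nothing of Thm 3.1 ∕ 3.4 asserted; COUNT-NEUTRAL; N06 NOT discharged; one finite lattice programme — nothing
continuum ∕ OS ∕ mass-gap ∕ Clay.  Cell `pub-ymgap` (HUMAN RULING D-0062), Track A node N06 [B9], 2026-08-30.  NEW file; nothing landed is modified.
-/

noncomputable section

namespace Literature.MathematicalPhysics.QuantumFieldTheory.Balaban1983to89.B9SectBCodedClassKnitYC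

open Complex
open B6GlobalChartV1 (PV)
open B6KLevelCensusIndexV1 (KIdx kGeo)
open B6Ineq2142KLevelV1 (β)
open B9BackgroundsKLevelV1 (shiftsV1 levV1)
open B9Eq39Adjoint (fluct)
open B9Eq335RegularityClasses (Cplx337)
open B9Eq360DeltaPrimeAY (AfldY blkY)
open B9PinMembersKLevelV1 (MemberY geo9Y)
open B9SectBCodedClassR (RegExtraY bg9YC)
open B9SectBGpLettersY (GVal)
open B9SectBGpFrameCodedYR (codingYx)
open B9SectBCodedClassY (cplxLettersY_of_cplx337)
open B9SectBCodedClassGY (cplxLettersGY_of_cplx337)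
open B9Eq359VarParBY (cVarGY cVarGY_nonneg varParBY_mono varParBY_parBY_of_cplx337)
open B9SectBCodedClassKnitY (C37KY ParVar337Y ParMemY cplxLettersY_of_cplx337_par)
open B9B8AveragingJunction (parKnitY parKnitY_inv)
open Node00 (SiteY BlkY IBondY CfgY blkCornerY parBY)

variable {𝔸 : Type} [NormedRing 𝔸] [NormedAlgebra ℂ 𝔸] [CompleteSpace 𝔸] [NormOneClass 𝔸]
variable {d ℓ : ℕ} {hd : 1 ≤ d + 1} {hL : Odd (ℓ + 1) ∧ 1 < ℓ + 1} {b₀ b₁ : ℝ} {Mstar : ℕ} (P : RegExtraY d ℓ hd hL b₀ b₁ Mstar 𝔸)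

/-! ## §1 `hclass` for the knit class at one member, over `bg9YC` -/

section Class

variable (G : Subgroup 𝔸ˣ) (x : MemberY d ℓ hd hL b₀ b₁ Mstar) (ιB : BlkY x.toKIdx → IBondY x.toKIdx) (R : ℝ → CfgY 𝔸 x.toKIdx → Prop)
  {Cq CqK MK aK β₀ : ℝ}

/-- ★★ **`hclass` AT ONE MEMBER FOR THE KNIT CLASS, OVER THE CLASS-PARAMETRIC CARRIER** — `B9SectBCodedClassKnitY.hclass_C37KY_at` with the base's regularity read on
`bg9YC 𝔸 G P x` (proof verbatim; only «`U` is `G`-valued» is used). [cite: Balaban1985BackgroundPropagators, (3.37) p.396, (3.35) p.396, (3.58) p.402, Thm 3.4 p.400] -/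
theorem hclass_C37KY_atC (hι : ∀ s : BlkY x.toKIdx, β x.toKIdx.hN x.toKIdx.D x.toKIdx.hk (ιB s) = s)
    (hG1 : ∀ u : 𝔸ˣ, u ∈ G → ‖(u : 𝔸)‖ ≤ 1) (hdM : 2 * ((d : ℝ) + 1) < (geo9Y x).M)
    {RK : ℝ → CfgY 𝔸 x.toKIdx → Prop} {Cp αK : ℝ} (hCp : 0 ≤ Cp)
    (hlaw : ParVar337Y G x.toKIdx (parKnitY x.toKIdx) RK Cp αK aK) (hmemK : ParMemY G x.toKIdx (parKnitY x.toKIdx) RK aK)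
    (hMK : MK ≤ (geo9Y x).M) {c35 α₀ α₁ : ℝ} {U U' : (bg9YC 𝔸 G P x).Cfg}
    (hα₀ : 0 < α₀) (haK : (geo9Y x).M * α₀ ≤ aK) (hR : R α₀ U) (hRK : RK α₀ U)
    (hreg : (bg9YC 𝔸 G P x).Reg335 c35 α₀ U) (hα₁ : 0 < α₁) (hα₁4 : α₁ ≤ 1 / 4) (hα₁K : α₁ ≤ αK) (hCpα : Cp * α₁ ≤ 1 / 2)
    (hβ₀ : (((ℓ : ℝ) + 1) ^ 4) * α₁ ≤ β₀) (h37 : (bg9YC 𝔸 G P x).Cplx337 α₁ U U') :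
    ∃ a : AfldY 𝔸 x.toKIdx, fluct (kGeo x.toKIdx).eta a = U' ∧
      C37KY G x ιB R (4 * ((d : ℝ) + 1) * Real.exp (3 * (((d : ℝ) + 1) / 2))) (4 * Cp) MK aK β₀ ((((ℓ : ℝ) + 1) ^ 4) * α₁) U a := by
  obtain ⟨A', hU', hcl⟩ := h37
  have hU : GVal G x.toKIdx U := hreg.1.1
  have hL4 : (1 : ℝ) ≤ ((ℓ : ℝ) + 1) ^ 4 := one_le_pow₀ (by have : (0 : ℝ) ≤ ℓ := Nat.cast_nonneg _; linarith)
  have hmono : α₁ ≤ (((ℓ : ℝ) + 1) ^ 4) * α₁ := le_mul_of_one_le_left hα₁.le hL4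
  have hmem : ∀ w : SiteY x.toKIdx, parKnitY x.toKIdx U (blkCornerY x.toKIdx (blkY x.toKIdx w)) w ∈ G :=
    fun w => hmemK α₀ U hα₀ haK hRK _ _
  refine ⟨A', hU'.symm, ?_, ?_, hmemK α₀ U hα₀ haK hRK, ⟨α₀, hα₀, hMK, haK, hR⟩, ⟨α₁, hα₁, hα₁4, rfl, hcl⟩, hβ₀⟩
  · exact ⟨⟨hU, cplxLettersY_of_cplx337 G x ιB hι hG1 hdM hU hα₁ hα₁4 hcl⟩, cplxLettersGY_of_cplx337 G x ιB hι hG1 hdM hU hα₁.le hcl,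
      varParBY_mono x.toKIdx (parBY x.toKIdx) (cVarGY_nonneg d ℓ) hmono (varParBY_parBY_of_cplx337 G x hG1 hU hα₁.le hα₁4 hcl)⟩
  · exact cplxLettersY_of_cplx337_par G x (parKnitY x.toKIdx) ιB hι hG1 hdM hU hα₁ hα₁4 hcl (parKnitY_inv x.toKIdx) hmem hCp hCpα
      (hlaw α₀ U hα₀ haK hRK hU α₁ A' hα₁ hα₁K hcl)

end Class

/-! ## §2 `hclass` for the knit class on a subfamily, over `bg9YC` -/

section Family

variable {J : Type} (f : J → MemberY d ℓ hd hL b₀ b₁ Mstar) (G : Subgroup 𝔸ˣ)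
  (ιB : ∀ j : J, BlkY (f j).toKIdx → IBondY (f j).toKIdx) (C38 : ∀ j : J, ℝ → CfgY 𝔸 (f j).toKIdx → AfldY 𝔸 (f j).toKIdx → Prop)
  (R RK : ∀ j : J, ℝ → CfgY 𝔸 (f j).toKIdx → Prop)

/-- ★ **`hclass` OF THE CLASS-PARAMETRIC CODED CARRIER ON A SUBFAMILY, for the codings `codingYx P G (f j) (C37KY …) (C38 j)`** — `hclass_C37KY_atC` at the members `f j`:
`r := L⁴`, `Cq = 4(d+1)e^{3(d+1)/2}`, `CqK = 4C_p`; thresholds `max (2(d+1)+1) M_K` on `M` and `a_K` on `M·α₀`; cap `αcap` (`≦ 1∕4`, `≦ α_K`, `C_p·αcap ≦ 1∕2`, `L⁴αcap ≦ β₀`); the two laws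
displayed per member; the regularity predicates bridged from the carrier's (3.35) (`hR`, `hRK`). [cite: Balaban1985BackgroundPropagators, (3.37) p.396, (3.35) p.396, (3.58) p.402, Thm 3.4 p.400] -/
theorem hclass_C37KY_onC (hι : ∀ (j : J) (s : BlkY (f j).toKIdx), β (f j).toKIdx.hN (f j).toKIdx.D (f j).toKIdx.hk (ιB j s) = s)
    (hG1 : ∀ u : 𝔸ˣ, u ∈ G → ‖(u : 𝔸)‖ ≤ 1) (c35 : ℝ) {Cp αK MK aK β₀ αcap : ℝ} (hCp : 0 ≤ Cp)
    (hlaw : ∀ j, ParVar337Y G (f j).toKIdx (parKnitY (f j).toKIdx) (RK j) Cp αK aK)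
    (hmemK : ∀ j, ParMemY G (f j).toKIdx (parKnitY (f j).toKIdx) (RK j) aK)
    (hR : ∀ j (α₀ : ℝ) (U : CfgY 𝔸 (f j).toKIdx), (bg9YC 𝔸 G P (f j)).Reg335 c35 α₀ U → R j α₀ U)
    (hRK : ∀ j (α₀ : ℝ) (U : CfgY 𝔸 (f j).toKIdx), (bg9YC 𝔸 G P (f j)).Reg335 c35 α₀ U → RK j α₀ U)
    (hcap4 : αcap ≤ 1 / 4) (hcapK : αcap ≤ αK) (hcapC : Cp * αcap ≤ 1 / 2) (hcapβ : (((ℓ : ℝ) + 1) ^ 4) * αcap ≤ β₀) :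
    ∀ (j : J) (α₀ α₁ : ℝ) (U U' : (bg9YC 𝔸 G P (f j)).Cfg), max (2 * ((d : ℝ) + 1) + 1) MK ≤ (geo9Y (f j)).M → 0 < α₀ → (geo9Y (f j)).M * α₀ ≤ aK →
      (bg9YC 𝔸 G P (f j)).Reg335 c35 α₀ U → 0 < α₁ → α₁ ≤ αcap → (bg9YC 𝔸 G P (f j)).Cplx337 α₁ U U' →
      ∃ a : (codingYx P G (f j) (C37KY G (f j) (ιB j) (R j) (4 * ((d : ℝ) + 1) * Real.exp (3 * (((d : ℝ) + 1) / 2))) (4 * Cp) MK aK β₀) (C38 j)).A,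
        (codingYx P G (f j) (C37KY G (f j) (ιB j) (R j) (4 * ((d : ℝ) + 1) * Real.exp (3 * (((d : ℝ) + 1) / 2))) (4 * Cp) MK aK β₀) (C38 j)).decA a = U' ∧
        (codingYx P G (f j) (C37KY G (f j) (ιB j) (R j) (4 * ((d : ℝ) + 1) * Real.exp (3 * (((d : ℝ) + 1) / 2))) (4 * Cp) MK aK β₀) (C38 j)).C37
          ((((ℓ : ℝ) + 1) ^ 4) * α₁) U a := by
  intro j α₀ α₁ U U' hM hα₀ haK hreg hα₁ hα₁c h37
  have hdM : 2 * ((d : ℝ) + 1) < (geo9Y (f j)).M := by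
    have := le_max_left (2 * ((d : ℝ) + 1) + 1) MK; linarith
  have hMK : MK ≤ (geo9Y (f j)).M := (le_max_right _ _).trans hM
  have hL4 : (0 : ℝ) ≤ ((ℓ : ℝ) + 1) ^ 4 := by positivity
  exact hclass_C37KY_atC P G (f j) (ιB j) (R j) (hι j) hG1 hdM hCp (hlaw j) (hmemK j) hMK hα₀ haK (hR j α₀ U hreg) (hRK j α₀ U hreg) hreg hα₁
    (hα₁c.trans hcap4) (hα₁c.trans hcapK) ((mul_le_mul_of_nonneg_left hα₁c hCp).trans hcapC)
    ((mul_le_mul_of_nonneg_left hα₁c hL4).trans hcapβ) h37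

end Family

end Literature.MathematicalPhysics.QuantumFieldTheory.Balaban1983to89.B9SectBCodedClassKnitYC

end
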